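import Summits.AnomalousDissipation.AnomalousDissipation.Theorems.BaireTransferDenseLoudDesignerForcesErgodicModelMixedDerivativeFieldSetup
import Literature.Analysis.FluidPDE.TorusNSLinearisationLinear
import Literature.Analysis.FluidPDE.TorusNSLinearisationBoundH1
import Mathlib.Topology.Instances.RealVectorSpace

/-!
# The candidate mixed derivative `Ẇ(s, y) h = S([DG(u_y(s))[w_h]] − [Δ DG(u_y(s))[w_h]])` of the smooth model is a
# bounded operator (tools for the registered stub S6c₂ `stub_modelMixedDerivativeFieldTools`, line
# ergodic-budget-selection-closing, block N-R of the crux `DenseLoudDesignerForces`)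

Summit-side glue over `…ErgodicModelMixedDerivativeFieldSetup.lean`.  On the admissible box around a base point
(`s ∈ [3a, 3]`, `s − a` in the Lipschitz window, `y ∈ ball y₀ (ρ/2)`), every `S(W(s, y) h)` is the state of a unique smooth
honest field `w_h` with Gevrey level `C₂L²‖h‖²` (`exists_smooth_rep_fderiv`).  The map

  `h ↦ S([DG(u_y(s))[w_h]] − [Δ DG(u_y(s))[w_h]])`,   `DG(u)[w] = P(νΔw − (u·∇)w − (w·∇)u)`,

is ADDITIVE (uniqueness of smooth representatives and `Torus.leray_linearisation_add_apply`) and BOUNDED by `C‖h‖`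
(frame-norm identity and `Torus.exists_h1_leray_linearisation_le`), hence a continuous real-linear operator
(`AddMonoidHom.toRealLinearMap`): `exists_mixedOp`.  This is the candidate value of both `∂_y ∂ₜ g` and `∂ₜ ∂_y g`.
Nothing is asserted; no definition is added.
-/

set_option linter.dupNamespace false

noncomputable section

open Set Function MeasureTheory Filter Metric
open scoped InnerProductSpace RealInnerProductSpace Topology ContDiff

namespace Summit.AnomalousDissipation.AnomalousDissipation.Theorems.DenseLoudDesignerForces.Ergodic

open Literature.Analysis.FunctionSpaces Literature.Analysis.FunctionSpaces.Torus
open Literature.Analysis.FluidPDE Literature.Analysis.FluidPDE.Torus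
open Summit.AnomalousDissipation.AnomalousDissipation.Theses.BaireTransfer
open Summit.AnomalousDissipation.AnomalousDissipation.Theorems.DenseLoudDesignerForces.Negative

/-- **The state of a sum of honest fields**: `[v + w] = [v] + [w]`. [folklore] -/
theorem stateOf_add' {v w : (UnitAddTorus (Fin 3)) → (EuclideanSpace ℝ (Fin 3))} (hv : IsSmooth v) (hvd : IsDivFree v)
    (hvm : HasZeroMean v) (hw : IsSmooth w) (hwd : IsDivFree w) (hwm : HasZeroMean w) :
    stateOf (fun x => v x + w x) = stateOf v + stateOf w := by
  obtain ⟨hn, hnd, hnm⟩ := honest_const_smul hw hwd hwm (-1)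
  have hneg : (fun x => (-1 : ℝ) • w x) = fun x => -w x := by funext x; simp
  rw [hneg] at hn hnd hnm
  have h := stateOf_sub' hv hvd hvm hn hnd hnm
  have hns : stateOf (fun x => -w x) = -stateOf w := by
    have h2 := stateOf_const_smul' hw hwd hwm (-1)
    rw [hneg] at h2
    rw [h2, neg_one_smul]
  simp only [sub_neg_eq_add, hns] at h
  exact h

/-- The sum of two smooth divergence-free fields is divergence free. [folklore] -/
theorem isDivFree_add' {v w : (UnitAddTorus (Fin 3)) → (EuclideanSpace ℝ (Fin 3))} (hv : IsSmooth v) (hw : IsSmooth w)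
    (hvd : IsDivFree v) (hwd : IsDivFree w) : IsDivFree (fun x => v x + w x) := by
  intro x
  have h1 : IsContDiff 1 v := hv.isContDiff (by simp)
  have h2 : IsContDiff 1 w := hw.isContDiff (by simp)
  have h := divergence_sub (h1.add h2) h2 x
  have hfun : (v + w) - w = v := by funext z; simp
  rw [hfun, hvd x, hwd x, sub_zero] at h
  rw [show (fun x => v x + w x) = v + w from rfl]
  exact h.symm

/-- **The projected linearisation of an honest field along an honest background is honest, together with its Laplacian.**
[folklore] -/
theorem honest_leray_linearisation (ν : ℝ) {u w : (UnitAddTorus (Fin 3)) → (EuclideanSpace ℝ (Fin 3))} (hu : IsSmooth u)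
    (hud : IsDivFree u) (hw : IsSmooth w) (hwd : IsDivFree w) :
    (IsSmooth (fun x => (ν • laplacian w x - (convect u w x + convect w u x)) -
        Torus.gradient (invLaplacian (divergence fun y => ν • laplacian w y - (convect u w y + convect w u y))) x) ∧
      IsDivFree (fun x => (ν • laplacian w x - (convect u w x + convect w u x)) -
        Torus.gradient (invLaplacian (divergence fun y => ν • laplacian w y - (convect u w y + convect w u y))) x) ∧
      HasZeroMean (fun x => (ν • laplacian w x - (convect u w x + convect w u x)) -
        Torus.gradient (invLaplacian (divergence fun y => ν • laplacian w y - (convect u w y + convect w u y))) x)) ∧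
    (IsSmooth (laplacian fun x => (ν • laplacian w x - (convect u w x + convect w u x)) -
        Torus.gradient (invLaplacian (divergence fun y => ν • laplacian w y - (convect u w y + convect w u y))) x) ∧
      IsDivFree (laplacian fun x => (ν • laplacian w x - (convect u w x + convect w u x)) -
        Torus.gradient (invLaplacian (divergence fun y => ν • laplacian w y - (convect u w y + convect w u y))) x) ∧
      HasZeroMean (laplacian fun x => (ν • laplacian w x - (convect u w x + convect w u x)) -
        Torus.gradient (invLaplacian (divergence fun y => ν • laplacian w y - (convect u w y + convect w u y))) x)) :=
  have h1 := isSmooth_leray_linearisation ν hu hw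
  have h2 := isDivFree_leray_linearisation ν hu hw
  ⟨⟨h1, h2, hasZeroMean_leray_linearisation ν hu hud hw hwd⟩, honest_laplacian h1 h2⟩

section Operator

variable {S : Finset (Fin 3 → ℤ)} {c : ↥S → (EuclideanSpace ℂ (Fin 3))} {ν : ℝ} (F : ModelFrame) (xF : Hsp) {U U' : Set Hsp}
  (u : Hsp → ℝ → (UnitAddTorus (Fin 3)) → (EuclideanSpace ℝ (Fin 3))) (p : Hsp → ℝ → (UnitAddTorus (Fin 3)) → ℝ)

set_option maxHeartbeats 400000 in
/-- **The candidate mixed derivative is a bounded operator.**  In the setting of `exists_smooth_rep_fderiv` (uniform Gevrey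
level `C₁` of the orbits on `[2a, 3]`, Gevrey–Lipschitz constant `C₂` on `[3a, 3]`, Lipschitz constant `L` of `y ↦ g r y`
on `ball y₀ ρ` for `r ∈ [r₀ − ε, r₀ + ε]`) there is an operator field `Φ` such that on the admissible box
(`s ∈ [3a, 3]`, `s − a ∈ [r₀ − ε, r₀ + ε]`, `y ∈ ball y₀ (ρ/2)`), for every `h` and every smooth honest `w` with
`[w] = S (W(s, y) h)`, `Φ s y h = S([DG(u_y(s))[w]] − [Δ DG(u_y(s))[w]])`: the right side, read on the chosen
representatives, is additive in `h` (uniqueness of smooth representatives, `Torus.leray_linearisation_add_apply`) and bounded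
by `C‖h‖` (frame-norm identity, `Torus.exists_h1_leray_linearisation_le`), hence real-linear and continuous
(`AddMonoidHom.toRealLinearMap`). [folklore] -/
theorem exists_mixedOp (hsol : ∀ y ∈ U, IsClassicalNSSolutionOn (Ioc 0 3) ν (fun _ => force S c) (u y) (p y))
    (hzm : ∀ y ∈ U, ∀ t ∈ Ioc (0 : ℝ) 3, HasZeroMean (u y t))
    (hSu : ∀ y ∈ U, ∀ t ∈ Ioc (0 : ℝ) 3, F.S (F.modelMap ν xF U' t y) = stateOf (u y t)) (hU : IsOpen U)
    (hsmooth : ∀ t ∈ Icc (0 : ℝ) 3, ContDiffOn ℝ ∞ (fun y => F.modelMap ν xF U' t y) U)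
    {a σ₁ C₁ σ₂ C₂ : ℝ} (ha : 0 < a) (hσ₁ : 0 < σ₁) (hσ₂ : 0 < σ₂) (hC₂ : 0 ≤ C₂)
    (hG₁ : ∀ y ∈ U, ∀ s ∈ Icc (2 * a) 3, ∀ S' : Finset (Fin 3 → ℤ), ∑ k ∈ S', Real.exp (2 * σ₁ * Real.sqrt (freqNormSq k)) *
        ‖UnitAddTorus.mFourierCoeff (EuclideanSpace.complexify ∘ u y s) k‖ ^ 2 ≤ C₁)
    (hLipG : ∀ y ∈ U, ∀ y' ∈ U, ∀ s ∈ Icc (3 * a) 3, ∀ S' : Finset (Fin 3 → ℤ),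
      ∑ k ∈ S', Real.exp (2 * σ₂ * Real.sqrt (freqNormSq k)) *
        ‖UnitAddTorus.mFourierCoeff (EuclideanSpace.complexify ∘ fun x => u y s x - u y' s x) k‖ ^ 2 ≤
        C₂ * ‖F.modelMap ν xF U' (s - a) y - F.modelMap ν xF U' (s - a) y'‖ ^ 2)
    {ε ρ L r₀ : ℝ} {y₀ : Hsp} (hρ : 0 < ρ) (hballU : ball y₀ ρ ⊆ U)
    (hLip : ∀ r ∈ Icc (r₀ - ε) (r₀ + ε), ∀ y ∈ ball y₀ ρ, ∀ y' ∈ ball y₀ ρ,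
      ‖F.modelMap ν xF U' r y - F.modelMap ν xF U' r y'‖ ≤ L * ‖y - y'‖) :
    ∃ Φ : ℝ → Hsp → (Hsp →L[ℝ] Hsp), ∀ s ∈ Icc (3 * a) 3, s - a ∈ Icc (r₀ - ε) (r₀ + ε) → ∀ y ∈ ball y₀ (ρ / 2),
      ∀ (h : Hsp) (w : (UnitAddTorus (Fin 3)) → (EuclideanSpace ℝ (Fin 3))), IsSmooth w → IsDivFree w → HasZeroMean w →
        stateOf w = F.S (fderiv ℝ (fun y' => F.modelMap ν xF U' s y') y h) →
        Φ s y h = F.S (stateOf (fun x => (ν • laplacian w x - (convect (u y s) w x + convect w (u y s) x)) -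
            Torus.gradient (invLaplacian (divergence fun z => ν • laplacian w z - (convect (u y s) w z + convect w (u y s) z))) x) -
          stateOf (laplacian fun x => (ν • laplacian w x - (convect (u y s) w x + convect w (u y s) x)) -
            Torus.gradient (invLaplacian (divergence fun z => ν • laplacian w z - (convect (u y s) w z + convect w (u y s) z))) x)) := by
  classical
  obtain ⟨Kb, hKb0, hKb⟩ := exists_h1_leray_linearisation_le (d := Fin 3) (Fintype.card_fin 3) ν σ₁ C₁ σ₂ hσ₁ hσ₂
  -- the construction at one admissible point
  have key : ∀ (s : ℝ) (y : Hsp), (s ∈ Icc (3 * a) 3 ∧ s - a ∈ Icc (r₀ - ε) (r₀ + ε) ∧ y ∈ ball y₀ (ρ / 2)) →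
      ∃ Φ₀ : Hsp →L[ℝ] Hsp, ∀ (h : Hsp) (w : (UnitAddTorus (Fin 3)) → (EuclideanSpace ℝ (Fin 3))), IsSmooth w → IsDivFree w →
        HasZeroMean w → stateOf w = F.S (fderiv ℝ (fun y' => F.modelMap ν xF U' s y') y h) →
        Φ₀ h = F.S (stateOf (fun x => (ν • laplacian w x - (convect (u y s) w x + convect w (u y s) x)) -
            Torus.gradient (invLaplacian (divergence fun z => ν • laplacian w z - (convect (u y s) w z + convect w (u y s) z))) x) -
          stateOf (laplacian fun x => (ν • laplacian w x - (convect (u y s) w x + convect w (u y s) x)) -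
            Torus.gradient (invLaplacian (divergence fun z => ν • laplacian w z - (convect (u y s) w z + convect w (u y s) z))) x)) := by
    rintro s y ⟨hs, hsr, hy⟩
    have hs0 : 0 < s := by linarith [hs.1]
    have hs3 : s ∈ Ioc (0 : ℝ) 3 := ⟨hs0, hs.2⟩
    have hyU : y ∈ U := hballU (ball_subset_ball (by linarith) hy)
    have hus : IsSmooth (u y s) := (hsol y hyU).smooth_velocity.isSmooth_slice hs3
    have hud : IsDivFree (u y s) := (hsol y hyU).divFree s hs3
    -- the chosen smooth representatives
    choose wc hwc using fun h => exists_smooth_rep_fderiv F xF u p hsol hzm hSu hU hsmooth hσ₂ hC₂ hLipG hρ hballU hLip hs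
      hs0 hsr hy h
    -- uniqueness of the representative
    have huniq : ∀ (h : Hsp) (w : (UnitAddTorus (Fin 3)) → (EuclideanSpace ℝ (Fin 3))), IsSmooth w → IsDivFree w →
        HasZeroMean w → stateOf w = F.S (fderiv ℝ (fun y' => F.modelMap ν xF U' s y') y h) → w = wc h :=
      fun h w hw hwd hwm hst => eq_of_stateOf_eq hw hwd hwm (hwc h).1 (hwc h).2.1 (hwc h).2.2.1 (hst.trans (hwc h).2.2.2.2.symm)
    -- the map on representatives
    set φ : Hsp → Hsp := fun h => F.S (stateOf (fun x => (ν • laplacian (wc h) x - (convect (u y s) (wc h) x + convect (wc h) (u y s) x)) -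
        Torus.gradient (invLaplacian (divergence fun z => ν • laplacian (wc h) z - (convect (u y s) (wc h) z + convect (wc h) (u y s) z))) x) -
      stateOf (laplacian fun x => (ν • laplacian (wc h) x - (convect (u y s) (wc h) x + convect (wc h) (u y s) x)) -
        Torus.gradient (invLaplacian (divergence fun z => ν • laplacian (wc h) z - (convect (u y s) (wc h) z + convect (wc h) (u y s) z))) x))
      with hφ
    -- additivity
    have hadd : ∀ h₁ h₂, φ (h₁ + h₂) = φ h₁ + φ h₂ := by
      intro h₁ h₂
      obtain ⟨hw₁, hw₁d, hw₁m, -, hst₁⟩ := hwc h₁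
      obtain ⟨hw₂, hw₂d, hw₂m, -, hst₂⟩ := hwc h₂
      have hsum : (fun x => wc h₁ x + wc h₂ x) = wc (h₁ + h₂) := by
        refine huniq (h₁ + h₂) _ (hw₁.add hw₂) ?_ ?_ ?_
        · exact isDivFree_add' hw₁ hw₂ hw₁d hw₂d
        · show ∫ x, (wc h₁ x + wc h₂ x) = 0
          rw [integral_add hw₁.integrable hw₂.integrable, hw₁m, hw₂m, add_zero]
        · rw [stateOf_add' hw₁ hw₁d hw₁m hw₂ hw₂d hw₂m, hst₁, hst₂, map_add, map_add]
      obtain ⟨⟨hL₁, hL₁d, hL₁m⟩, hΔ₁, hΔ₁d, hΔ₁m⟩ := honest_leray_linearisation ν hus hud hw₁ hw₁d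
      obtain ⟨⟨hL₂, hL₂d, hL₂m⟩, hΔ₂, hΔ₂d, hΔ₂m⟩ := honest_leray_linearisation ν hus hud hw₂ hw₂d
      have hlin : (fun x => (ν • laplacian (wc (h₁ + h₂)) x - (convect (u y s) (wc (h₁ + h₂)) x + convect (wc (h₁ + h₂)) (u y s) x)) -
          Torus.gradient (invLaplacian (divergence fun z => ν • laplacian (wc (h₁ + h₂)) z -
            (convect (u y s) (wc (h₁ + h₂)) z + convect (wc (h₁ + h₂)) (u y s) z))) x) =
          fun x => ((ν • laplacian (wc h₁) x - (convect (u y s) (wc h₁) x + convect (wc h₁) (u y s) x)) -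
            Torus.gradient (invLaplacian (divergence fun z => ν • laplacian (wc h₁) z - (convect (u y s) (wc h₁) z + convect (wc h₁) (u y s) z))) x) +
          ((ν • laplacian (wc h₂) x - (convect (u y s) (wc h₂) x + convect (wc h₂) (u y s) x)) -
            Torus.gradient (invLaplacian (divergence fun z => ν • laplacian (wc h₂) z - (convect (u y s) (wc h₂) z + convect (wc h₂) (u y s) z))) x) := by
        rw [← hsum]
        funext x
        exact leray_linearisation_add_apply ν hus hw₁ hw₂ x
      have hlap : (laplacian fun x => ((ν • laplacian (wc h₁) x - (convect (u y s) (wc h₁) x + convect (wc h₁) (u y s) x)) -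
            Torus.gradient (invLaplacian (divergence fun z => ν • laplacian (wc h₁) z - (convect (u y s) (wc h₁) z + convect (wc h₁) (u y s) z))) x) +
          ((ν • laplacian (wc h₂) x - (convect (u y s) (wc h₂) x + convect (wc h₂) (u y s) x)) -
            Torus.gradient (invLaplacian (divergence fun z => ν • laplacian (wc h₂) z - (convect (u y s) (wc h₂) z + convect (wc h₂) (u y s) z))) x)) =
          fun x => (laplacian (fun x => (ν • laplacian (wc h₁) x - (convect (u y s) (wc h₁) x + convect (wc h₁) (u y s) x)) -
            Torus.gradient (invLaplacian (divergence fun z => ν • laplacian (wc h₁) z - (convect (u y s) (wc h₁) z + convect (wc h₁) (u y s) z))) x) x) +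
          (laplacian (fun x => (ν • laplacian (wc h₂) x - (convect (u y s) (wc h₂) x + convect (wc h₂) (u y s) x)) -
            Torus.gradient (invLaplacian (divergence fun z => ν • laplacian (wc h₂) z - (convect (u y s) (wc h₂) z + convect (wc h₂) (u y s) z))) x) x) := by
        funext x
        exact laplacian_add_apply hL₁ hL₂ x
      simp only [hφ]
      rw [hlin, hlap, stateOf_add' hL₁ hL₁d hL₁m hL₂ hL₂d hL₂m, stateOf_add' hΔ₁ hΔ₁d hΔ₁m hΔ₂ hΔ₂d hΔ₂m, add_sub_add_comm, map_add]
    -- the bound `‖φ h‖ ≤ C ‖h‖`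
    have hbound : ∀ h, ‖φ h‖ ≤ Real.sqrt (Kb * (C₂ * L ^ 2)) * ‖h‖ := by
      intro h
      obtain ⟨hw, hwd, hwm, hwG, -⟩ := hwc h
      obtain ⟨⟨hL₁, hL₁d, hL₁m⟩, -⟩ := honest_leray_linearisation ν hus hud hw hwd
      have hsq : ‖φ h‖ ^ 2 ≤ (Real.sqrt (Kb * (C₂ * L ^ 2)) * ‖h‖) ^ 2 := by
        rw [hφ]
        dsimp only
        rw [F.norm_frame_sq hL₁ hL₁d hL₁m, mul_pow, Real.sq_sqrt (by positivity)]
        have hb := hKb (u y s) (wc h) hus hw hwm (hG₁ y hyU s ⟨by linarith [hs.1], hs.2⟩) (C₂ * L ^ 2 * ‖h‖ ^ 2) hwG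
        linarith
      exact (pow_le_pow_iff_left₀ (norm_nonneg _) (by positivity) two_ne_zero).1 hsq
    -- the continuous real-linear operator
    set φh : Hsp →+ Hsp := AddMonoidHom.mk' φ hadd with hφh
    have hcont : Continuous φh := AddMonoidHomClass.continuous_of_bound φh _ hbound
    refine ⟨φh.toRealLinearMap hcont, fun h w hw hwd hwm hst => ?_⟩
    rw [AddMonoidHom.coe_toRealLinearMap, hφh, AddMonoidHom.mk'_apply, huniq h w hw hwd hwm hst]
  choose! Φ hΦ using key
  exact ⟨Φ, fun s hs hsr y hy h w hw hwd hwm hst => hΦ s y ⟨hs, hsr, hy⟩ h w hw hwd hwm hst⟩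

end Operator

end Summit.AnomalousDissipation.AnomalousDissipation.Theorems.DenseLoudDesignerForces.Ergodic

end
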